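import Summits.BirchSwinnertonDyer.Rank1Residual.P2.CongruentNumberSilentEvenFiveThetaRecursion
import Summits.BirchSwinnertonDyer.Rank1Residual.P2.CongruentNumberSilentEvenFiveThetaFourTorsion
import Literature.NumberTheory.EllipticCurves.Monsky1990.MockHeegnerCongruentNumbers
import HarnessLib

/-!
# Cell «bsd-monsky» (prover-B): THEOREM B IN THE KERNEL modulo route B's one display — TYZ genus-point data
# + PROOF-B's `θ`-package ⟹ `𝓛(2pq)` odd wherever `g(2pq)` is odd ⟹ C-P2-1 on `𝒮⁻` — nothing asserted

HONEST FRAMING (cell `bsd-monsky`, run/shared/lean/pub/bsd-monsky/; README §1): this file asserts NO arithmetic fact.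
Every theorem is CONDITIONAL on named hypotheses: the display `thetaGenusPointDatum p q` of
`P2/CongruentNumberSilentEvenFiveThetaDisplay.lean` (TYZ data `D` with `D.Printed` + an automorphism `θ` with
PROOF-B's `θ`-package `thetaSpec D θ`; kernel debt `K_B`, NOT a Literature fact), GZK
(`rank_eq_analyticRank_of_analyticRank_le_one`, only to produce the generator `α_n` that TYZ Thm. 3.5 presupposes,
exactly as in W2's `uPlus_genusField_of`), Rédei–Reichardt (`hR`, for `g(2pq)` odd on `𝒮⁻`) and, for the observable
form only, Monsky 1990 Cor 5.15 (`h515`, door D-CN-5). What is PROVED here is the deduction — PROOF-B §4 (Lemma 1),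
§7 (assembly of Lemma 5) and §8 (Theorem B) — in the kernel:

* (part 1, `P2/CongruentNumberSilentEvenFiveThetaRecursion.lean`) `recursionIndex (2pq) = {pq}` (`q ≡ 3 (8)`) / `{q}` (`q ≡ 7 (8)`), `recursionIndex (pq) = {p}`, `recursionIndex p = ∅`:
  the displayed `recursion` of TYZ §3.1 has exactly THREE blocks for `N = 2pq`,
  `P(N) = Z(N) − i^{e₁}𝓛(2)(Z(pq) − i^{e₂}𝓛(q)Z(p))` with `e₁` even, `e₂` odd (`epsSpec`), resp. TWO blocks
  `P(N) = Z(N) − i^{e₁}𝓛(2p)Z(q)` (PROOF-B Lemma 1); hence, from `thetaSpec` ((B1)–(B3), `θ[i] = −[i]θ`,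
  `[i]^kτ(1) = τ(1)`): `(θ − 1)P(N) = g(N)·w + mτ(1)` (PROOF-B Lemma 5, assembly — the recursion is used EXACTLY,
  not modulo `2A(ℍ′_N)`: Prop. 3.4 would lose the `2`-torsion point `w`).
* §4 the `E`-side `ρ`-free relation of W2 (Steps 1–2 of `uPlus_genusField_of`, VERBATIM: `thm35Main` with `ρ` and
  `α_n`, the `rhoSubgroup` index lemma, the twist transfer and halving; the rank-one input `hr` made EXPLICIT) with the comparison point `R′ ∈ A₂(ℍ′_N)` now
  recorded as `θ`-FIXED (`R′` comes from `E_N(ℚ) ≅ A₂(K_N)⁻` and `θ ∈ Gal(ℍ′_N/K_N)`): `2φ(P(N)) − ε′𝓛(N)R′ ∈ tors`,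
  `R′ = φ(Q₁)`.
* §5 THEOREM B: if `𝓛(N) = 2m` then `P(N) = (ε′m)Q₁ + t′` with `t′ ∈ A(ℍ′_N)_tor`, so `4t′ = 0` (TYZ Lemma 3.18,
  displayed) and `(θ−1)t′ ∈ ℤτ(i/2)` ((θ2)), while `φ((θ−1)Q₁) = (θ−1)R′ = 0` puts `(θ−1)Q₁ ∈ {0, τ(1)} ⊂ ℤτ(i/2)`;
  so `(θ−1)P(N) ∈ ℤτ(i/2)`. With part 1 and `g(N)` odd: `w ∈ ℤτ(i/2)`, hence `θw + w = 0` (`θτ(i/2) = −τ(i/2)`),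
  contradicting `θw + w = τ(1) ≠ 0` ((B0)). [PROOF-B §8 runs the same contradiction inside `E(M)`, `M = L_N(i)`,
  using `E(M)_tor = E[4]` (its Lemma 3) and `φ(w) ∉ (c−1)E[4]`; the kernel pulls the torsion bookkeeping back to
  `A(ℍ′_N)` through the halving point `Q₁`, as W2 does, so that TYZ Lemma 3.18 (displayed) replaces PROOF-B Lemma 3 (i).]
* §5b the REDUCED package `thetaSpecCFT` ((θ2) replaced by `θ(√−2) = −√−2`, discharged by the kernel theorem of
  `P2/CongruentNumberSilentEvenFiveThetaFourTorsion.lean`) and `thetaSpec_of_thetaSpecCFT`, `odd_scriptL_of_thetaSpecCFT`.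
* §6 `theoremB_of_thetaGenusPointDatum (hΘ) (hGZK)` and the GZK-FREE `theoremB_of_thetaGenusPointDatum_of_cor515 (hΘ) (h515)`
  (rank-one input of (REP) from Monsky 1990 Cor 5.15): `g(2pq)` odd ⟹ `∃ L` odd, `IsScriptL (2pq) L`, all `p ≡ 5 (8)`,
  `q ≡ 3 (4)` — exactly the hypothesis `hThmB` of the landed hook `P2/CongruentNumberSilentEvenFiveProofBHook.lean`; the
  compositions with the hook (C-P2-1 both forms, whole even-five family) are the sibling file
  `P2/CongruentNumberSilentEvenFiveThetaDescentDoors.lean`.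

So route B's Lean enclosure of C-P2-1 is: {`thetaGenusPointDatum` (K_B), RR, `h515`} (the rank-one input that TYZ
Thm. 3.5 presupposes is taken from Cor 5.15: `…_of_cor515`, NO GZK) or {`thetaGenusPointDatum`, GZK, RR, `h515`} (rank from GZK as in W2) — versus route A's
{tier-1 `thm28_cmPointSystem` + F-GZ `heegnerIndex_scriptL_two_mul_five_mul` + K1, `h515`} (typer, HOME/lean/PLAN.md);
the two share NO display. Discharging `K_B` = displaying TYZ Prop. 3.2 / Thm. 3.6 with the CM points `z_n`, `Cl′_n` and
the Artin map, and redoing PROOF-B Lemmas 4–5 as Galois bookkeeping in the kernel; its (θ2) conjunct is a finite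
computation on `A[4] ⊂ A(ℚ(ζ₈))` provable from `θ(i) = −i`, `θ(√2) = √2` and Lemma 3.18's count `#A(ℍ′_N)[4] = 16`.
Nothing booked; no mark moved.

References: HOME/proof/PROOF-B.md (v1.2) §2.2, §4 (Lemma 1), §7 (Lemmas 4–5), §8, §9, §11; HOME/REFEREE-VERDICT-B.md;
[TianYuanZhang2017] §3.1 (recursion, p0011 L67–L73), Thm. 3.3 (ε-types), Thm. 3.5, Thm. 3.6, Lemma 3.18, Prop. 3.2;
[Monsky1990MockHeegner] Cor. 5.15 (2′); [LiMa2008] Thm. 0.4; [Miller2011LMS] Def. 1.1; W2 files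
`Literature/…/TianYuanZhang2017/{GenusDescentAbstract,GenusDescentEnSide,GenusDescentTwist,UPlusOfGenusPointData}.lean`.
-/

noncomputable section

open scoped Classical

open WeierstrassCurve WeierstrassCurve.Affine NumberField Literature.NumberTheory.EllipticCurves
  Literature.NumberTheory.EllipticCurves.Rank1Residual
  Literature.NumberTheory.EllipticCurves.Rank1Residual.Typed
  Literature.NumberTheory.EllipticCurves.Monsky1990
  Literature.NumberTheory.EllipticCurves.TianYuanZhang2017
  Literature.NumberTheory.EllipticCurves.TianYuanZhang2017.W2
  Literature.NumberTheory.QuadraticFields.RedeiReichardt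

set_option autoImplicit false

namespace Summit.BirchSwinnertonDyer.Rank1Residual.P2

open ThetaDescent

namespace ThetaDescent

variable {n : ℕ}

/-- `2pq` for primes `p ≡ 5 (mod 8)`, `q ≡ 3 (mod 4)` is in Monsky's Cor. 5.15 family (2′) (both residue halves of
`q`), hence square-free, `≡ 6 (mod 8)` and non-zero. [cite: Monsky1990MockHeegner, Cor. 5.15 (2) (p. 66)] -/
theorem isCor515Family_two_mul_five_mul' {p q : ℕ} (hp : p.Prime) (hq : q.Prime) (hp5 : p % 8 = 5)
    (hq4 : q % 4 = 3) : IsCor515Family (2 * (p * q)) := by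
  have hq8 : q % 8 = 3 ∨ q % 8 = 7 := by omega
  exact Or.inr (Or.inr (Or.inr (Or.inl ⟨p, q, hp, hq, hp5, hq8, rfl⟩)))

/-! ## §4 The `E`-side `ρ`-free relation with a `θ`-FIXED comparison point (W2 Steps 1–2, verbatim) -/

/-- **(REP), `θ`-fixed form.** From `thm35Main` (WITH `ρ`, `α_n`), rank `E_n(ℚ) ≤ 1` whenever `𝓛(n) ≠ 0` (the hypothesis
`hr`: from GZK, or on Monsky's family from Cor 5.15 — see the two corollaries of §5) and W2's twist transfer: there are `R′ ∈ A₂(ℍ′_n)` FIXED by `θ` (it comes from `E_n(ℚ) ≅ A₂(K_n)⁻` and `θ ∈ Gal(ℍ′_n/K_n)`), a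
`φ`-preimage `Q₁` of `R′`, and `ε′ ∈ ℤ` with `2φ(P(n)) − ε′𝓛(n)R′` torsion. (W2 `uPlus_genusField_of`, Steps 1–2,
with `N_E R′ = 0` replaced by `θR′ = R′`.) [cite: TianYuanZhang2017, Thm. 3.5 and its proof (p0011 L94–L112, p0016 L45–L54)] -/
theorem exists_theta_fixed_rep (hsq : Squarefree n) (h8 : n % 8 = 5 ∨ n % 8 = 6 ∨ n % 8 = 7)
    (hn : n ∈ n.divisors) (D : GenusPointData n)
    (hr :
      letI := isElliptic_congruentNumberCurve hsq.ne_zero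
      D.scriptL n ≠ 0 → (congruentNumberCurve n).mordellWeilRank ≤ 1)
    (hLspec : D.scriptLSpec) (h35 : D.thm35Main) (θ : D.H ≃ₐ[ℚ] D.H) (hθK : θ (D.sqrtNeg n) = D.sqrtNeg n) :
    ∃ (R' : A2Point D.H) (Q₁ : APoint D.H) (ε' : ℤ),
      thetaPtE D θ R' = R' ∧ φH D Q₁ = R' ∧
        IsOfFinAddOrder ((2 : ℕ) • φH D (D.P n) - (ε' * D.scriptL n) • R') := by
  letI := isElliptic_congruentNumberCurve hsq.ne_zero
  have hn1 : 1 < n := by rcases h8 with h | h | h <;> omega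
  obtain ⟨ρ, hρ⟩ := stub_S3 hsq
  set L := D.scriptL n with hLdef
  have hL : IsScriptL n L := hLspec n hn hn1
  obtain ⟨ΘA, ΘE, hΘAmem, hΘAsurj, -, -, hinter, hK2⟩ := stub_twist hsq hn
  by_cases hL0 : L = 0
  · refine ⟨0, 0, 0, map_zero _, map_zero _, ?_⟩
    rw [smul_zero, sub_zero]
    exact ((φH D).isOfFinAddOrder ((h35 hn ρ hρ).1 hL0)).nsmul
  · have hr' : (congruentNumberCurve n).mordellWeilRank ≤ 1 := hr hL0
    obtain ⟨R, hR⟩ := stub_S0 hr'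
    obtain ⟨α₀, hα₀⟩ := stub_S0' hr'
    obtain ⟨ε, -, t₂, ht₂, hψα⟩ := stub_S1 hsq (ψQ n) xSqClass_eq_one_iff_exists_ψQ hρ hR hα₀
    obtain ⟨s, -, hF1⟩ := (h35 hn ρ hρ).2 hL0 (ΘA α₀) (generatesFreePart_of_twist ΘA hΘAmem hΘAsurj hα₀)
    have hF1E := step1E_fixed D hn ΘA ΘE hinter hF1 ht₂ hψα
    obtain ⟨Q₁, hQ₁⟩ := hK2 D R
    exact ⟨_, Q₁, s * ε, thetaPtE_map_embK D hn θ hθK (ΘE R), hQ₁, hF1E⟩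

/-! ## §5 THEOREM B in the kernel: `g(N)` odd ⟹ `𝓛(N)` odd, modulo the display and a rank-one input (GZK or Cor 5.15) -/

/-- **THEOREM B (PROOF-B §8) in the kernel, modulo the `θ`-display**: for primes `p ≡ 5 (mod 8)`, `q ≡ 3 (mod 4)`,
TYZ data `D` for `N = 2pq` with `D.Printed`, an automorphism `θ` with `thetaSpec D θ`, rank `E_N(ℚ) ≤ 1` once `𝓛(N) ≠ 0`
(`hr`; see the GZK and Cor 5.15 corollaries below), and `g(N)` odd, the sign choice `D.scriptL N` of `𝓛(N)` is ODD. Proof: if `𝓛(N) = 2m`, the `E`-side relation gives `P(N) = (ε′m)Q₁ + t′` with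
`t′ ∈ A(ℍ′_N)_tor = A[4]` (Lemma 3.18) and `φ((θ−1)Q₁) = (θ−1)R′ = 0`, so `(θ−1)P(N) ∈ ℤτ(1) + (θ−1)A[4] ⊆ ℤτ(i/2)`;
but by the recursion and the block evaluations `(θ−1)P(N) ∈ g(N)·w + ℤτ(1)` with `g(N)` odd, whence
`w ∈ ℤτ(i/2)` and `θw + w = 0 ≠ τ(1)` (`θτ(i/2) = −τ(i/2)`). (PROOF-B §8 runs the same contradiction on `E(M)`,
`M = L_N(i)`; here the torsion bookkeeping is pulled back to `A(ℍ′_N)` through `Q₁`, as in W2.)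
[cite: TianYuanZhang2017, Thm. 3.5 (p0011 L94–L112), Lemma 3.18 (p0017 L152–L153), §3.1 (p0011 L67–L73)] -/
theorem odd_scriptL_of_thetaSpec_of_rank {p q : ℕ} (hp : p.Prime) (hq : q.Prime) (hp5 : p % 8 = 5)
    (hq4 : q % 4 = 3) (D : GenusPointData (2 * (p * q))) (hD : D.Printed)
    (hr :
      letI := isElliptic_congruentNumberCurve (Nat.mul_ne_zero two_ne_zero (Nat.mul_ne_zero hp.ne_zero hq.ne_zero))
      D.scriptL (2 * (p * q)) ≠ 0 → (congruentNumberCurve (2 * (p * q))).mordellWeilRank ≤ 1)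
    (θ : D.H ≃ₐ[ℚ] D.H) (hθ : thetaSpec D θ) (hg : Odd (gK (2 * (p * q)))) :
    Odd (D.scriptL (2 * (p * q))) := by
  have hN0 : (2 * (p * q)) ≠ 0 := Nat.mul_ne_zero two_ne_zero (Nat.mul_ne_zero hp.ne_zero hq.ne_zero)
  have hN6 : (2 * (p * q)) % 8 = 6 := by
    have : (p * q) % 4 = 3 := by rw [Nat.mul_mod, show p % 4 = 1 by omega, hq4]
    omega
  have hsq : Squarefree (2 * (p * q)) :=
    (isCor515Family_two_mul_five_mul' hp hq hp5 hq4).squarefree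
  have hn : 2 * (p * q) ∈ (2 * (p * q)).divisors := Nat.mem_divisors_self _ hN0
  obtain ⟨hLspec, heps, hrec, -, h35, -, -, -, h318, -, -⟩ := hD
  have hθ' := hθ
  obtain ⟨hθK, hθi, hA4, -, -, -, -⟩ := hθ'
  by_contra hodd
  obtain ⟨m, hm⟩ := Int.not_odd_iff_even.mp hodd
  -- the `E`-side relation with a `θ`-fixed `R′`
  obtain ⟨R', Q₁, ε', hR'fix, hQ₁, hF1E⟩ :=
    exists_theta_fixed_rep hsq (Or.inr (Or.inl hN6)) hn D hr hLspec h35 θ hθK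
  -- `θ − 1` on `A` and on `A₂`
  set DA : APoint D.H →+ APoint D.H := thetaPt D θ - AddMonoidHom.id _ with hDA
  set DE : A2Point D.H →+ A2Point D.H := thetaPtE D θ - AddMonoidHom.id _ with hDE
  have hDA_apply : ∀ x, DA x = thetaPt D θ x - x := fun x => rfl
  have hcomm : ∀ x, φH D (DA x) = DE (φH D x) := by
    intro x
    rw [hDA_apply, map_sub, φH_thetaPt]; rfl
  have hDER : DE R' = 0 := by
    show thetaPtE D θ R' - R' = 0
    rw [hR'fix, sub_self]
  have h2 : (2 : ℕ) • (tauOne : APoint D.H) = 0 := two_nsmul_tauOne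
  have hker : ∀ x, φH D x = 0 → x = 0 ∨ x = tauOne := fun x hx => (φH_eq_zero_iff D x).mp hx
  obtain ⟨t', ht', hDAQ₁, hDAP⟩ :=
    W2.Abstract.exists_decomp_NA (φH D) h2 hker DA DE hcomm hDER hQ₁ (m := m) (by rw [hm]; ring) hF1E
  -- `(θ−1)t′ ∈ ℤτ(i/2)` and `(θ−1)Q₁ ∈ ℤτ(1) = 2ℤτ(i/2)`
  have h4t' : (4 : ℕ) • t' = 0 := ((h318.2 (Nat.even_iff.mpr (by omega))).1 t' ht')
  obtain ⟨k₁, hk₁⟩ := hA4 t' h4t'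
  have h2τ : (2 : ℤ) • D.tauIHalf = (tauOne : APoint D.H) := by
    rw [two_zsmul, ← two_nsmul]; exact (tau_facts D).2.2.1
  have hDAQ₁' : ∃ k₂ : ℤ, DA Q₁ = k₂ • D.tauIHalf := by
    rcases (W2.Abstract.mem_zmultiples_iff_of_two_nsmul_eq_zero h2).mp hDAQ₁ with h0 | h0
    · exact ⟨0, by rw [h0, zero_smul]⟩
    · exact ⟨2, by rw [h0, h2τ]⟩
  obtain ⟨k₂, hk₂⟩ := hDAQ₁'
  have hDAP' : DA (D.P (2 * (p * q))) = (ε' * m * k₂ + k₁) • D.tauIHalf := by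
    rw [hDAP, hk₂, hDA_apply t', hk₁, smul_smul, add_smul]
  -- the recursion side: `(θ−1)P(N) = g•w + m'•τ(1)`
  obtain ⟨w, m', hw2, hww, hrecθ⟩ := theta_sub_P_eq hp hq hp5 hq4 D hrec heps θ hθ
  rw [hDA_apply] at hDAP'
  rw [hDAP'] at hrecθ
  -- `w ∈ ℤτ(i/2)`
  obtain ⟨r, hr⟩ := hg
  have hw : ∃ K : ℤ, w = K • D.tauIHalf := by
    have h2w : ∃ j : ℤ, (2 : ℕ) • w = j • D.tauIHalf := by
      rcases hw2 with h0 | h0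
      · exact ⟨0, by rw [h0, zero_smul]⟩
      · exact ⟨2, by rw [h0, h2τ]⟩
    obtain ⟨j, hj⟩ := h2w
    refine ⟨ε' * m * k₂ + k₁ - m' * 2 - (r : ℤ) * j, ?_⟩
    have e3 : (gK (2 * (p * q)) : ℤ) • w = (ε' * m * k₂ + k₁) • D.tauIHalf - m' • tauOne :=
      eq_sub_of_add_eq hrecθ.symm
    have e4 : w = (gK (2 * (p * q)) : ℤ) • w - (r : ℤ) • ((2 : ℕ) • w) := by
      rw [hr]; push_cast; module
    calc w = (gK (2 * (p * q)) : ℤ) • w - (r : ℤ) • ((2 : ℕ) • w) := e4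
      _ = ((ε' * m * k₂ + k₁) • D.tauIHalf - m' • tauOne) - (r : ℤ) • (j • D.tauIHalf) := by rw [e3, hj]
      _ = ((ε' * m * k₂ + k₁) • D.tauIHalf - m' • ((2 : ℤ) • D.tauIHalf)) - (r : ℤ) • (j • D.tauIHalf) := by
          rw [h2τ]
      _ = (ε' * m * k₂ + k₁ - m' * 2 - (r : ℤ) * j) • D.tauIHalf := by module
  obtain ⟨K, hK⟩ := hw
  -- `θw + w = 0`, contradiction with `θw + w = τ(1) ≠ 0`
  have h0 : thetaPt D θ w + w = 0 := by
    rw [hK, map_zsmul, thetaPt_tauIHalf D θ hθi, smul_neg, neg_add_cancel]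
  rw [h0] at hww
  exact tauOne_ne_zero hww.symm

/-- **THEOREM B in the kernel, rank input from GZK** (`𝓛(N) ≠ 0` ⟹ `ord_{s=1} L(E_N, s) = 1` ⟹ rank `1`), as in W2's
`uPlus_genusField_of`. [cite: TianYuanZhang2017, Thm. 3.5 (p0011 L94–L112)] -/
theorem odd_scriptL_of_thetaSpec {p q : ℕ} (hp : p.Prime) (hq : q.Prime) (hp5 : p % 8 = 5) (hq4 : q % 4 = 3)
    (hGZK : rank_eq_analyticRank_of_analyticRank_le_one) (D : GenusPointData (2 * (p * q))) (hD : D.Printed)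
    (θ : D.H ≃ₐ[ℚ] D.H) (hθ : thetaSpec D θ) (hg : Odd (gK (2 * (p * q)))) :
    Odd (D.scriptL (2 * (p * q))) := by
  have hN := isCor515Family_two_mul_five_mul' hp hq hp5 hq4
  haveI := isElliptic_congruentNumberCurve hN.ne_zero
  refine odd_scriptL_of_thetaSpec_of_rank hp hq hp5 hq4 D hD (fun hL0 => ?_) θ hθ hg
  have hL : IsScriptL (2 * (p * q)) (D.scriptL (2 * (p * q))) :=
    hD.1 _ (Nat.mem_divisors_self _ hN.ne_zero) (by have := Nat.mul_pos hp.pos hq.pos; omega)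
  have har := S4 hN.squarefree hN.mod_eight hL hL0
  rw [(hGZK (congruentNumberCurve (2 * (p * q))) har).1]; exact har

/-- **THEOREM B in the kernel, rank input from Monsky 1990 Cor 5.15** (`h515`: rank `E_{2pq}(ℚ) = 1` on Monsky's family,
both symbols) — NO GZK binder. [cite: Monsky1990MockHeegner, Cor. 5.15 (2′) (p. 66), Remark (2) (p. 67)] -/
theorem odd_scriptL_of_thetaSpec_of_cor515 {p q : ℕ} (hp : p.Prime) (hq : q.Prime) (hp5 : p % 8 = 5)
    (hq4 : q % 4 = 3) (h515 : cor515_rank_eq_one_and_card_selmerGroup_two) (D : GenusPointData (2 * (p * q)))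
    (hD : D.Printed) (θ : D.H ≃ₐ[ℚ] D.H) (hθ : thetaSpec D θ) (hg : Odd (gK (2 * (p * q)))) :
    Odd (D.scriptL (2 * (p * q))) := by
  have hN := isCor515Family_two_mul_five_mul' hp hq hp5 hq4
  haveI := isElliptic_congruentNumberCurve hN.ne_zero
  exact odd_scriptL_of_thetaSpec_of_rank hp hq hp5 hq4 D hD (fun _ => ((h515 _ hN).1).le) θ hθ hg

end ThetaDescent

open ThetaDescent

/-! ## §5b The REDUCED package: conjunct (θ2) discharged by `…ThetaFourTorsion.lean` (θ(√−2) = −√−2 suffices) -/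

/-- **`thetaSpecCFT` — route B's `θ`-package with (θ2) replaced by the class-field-theory value `θ(√−2) = −√−2`**
(`(1+N, −2)₂ = (7,−1)₂(7,2)₂ = −1`; PROOF-B Lemma 4 (θ1)): conjuncts (θ0) `θ(√−N) = √−N`, (θ1) `θ(i) = −i`,
(θ1′) `θ(√−2) = −√−2`, and PROOF-B Lemma 5 (B0)–(B3) verbatim as in `thetaSpec`. Every conjunct is now a statement
about the CM points / class field theory (no finite computation left): the display a discharge of `K_B` must provide.
A predicate; nothing asserted. [cite: TianYuanZhang2017, Prop. 3.2 (p0010 L106–L115), Thm. 3.6 (p0012 L22–L36), §3.1 (p0011 L53–L66)] -/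
def thetaSpecCFT {p q : ℕ} (D : GenusPointData (2 * (p * q))) (θ : D.H ≃ₐ[ℚ] D.H) : Prop :=
  θ (D.sqrtNeg (2 * (p * q))) = D.sqrtNeg (2 * (p * q)) ∧
  θ D.im = -D.im ∧
  θ (D.sqrtNeg 2) = -D.sqrtNeg 2 ∧
  (∃ w : APoint D.H, ((2 : ℕ) • w = 0 ∨ (2 : ℕ) • w = tauOne) ∧ thetaPt D θ w + w = tauOne ∧
    ∃ m : ℤ, thetaPt D θ (D.Z (2 * (p * q))) - D.Z (2 * (p * q)) = (gK (2 * (p * q)) : ℤ) • w + m • tauOne) ∧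
  (q % 8 = 3 → thetaPt D θ (D.Z (p * q)) = D.Z (p * q)) ∧
  (q % 8 = 7 → thetaPt D θ (D.Z q) = D.Z q) ∧
  (q % 8 = 3 → ∃ m : ℤ, thetaPt D θ (D.Z p) + D.Z p = m • tauOne)

/-- **`thetaSpecCFT ⟹ thetaSpec`**: conjunct (θ2) `(θ − 1)A(ℍ′_N)[4] ⊆ ℤτ(i/2)` follows from `θ(i) = −i` and
`θ(√2) = √2` (`√2 := i·√−2`, so `θ(√2) = (−i)(−√−2) = √2`) by the kernel theorem
`ThetaDescent.exists_map_sub_eq_zsmul_of_four_nsmul_eq_zero` (PROOF-B (T-c) on coordinates).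
[cite: TianYuanZhang2017, Lemma 3.16 (p0017 L98–L113), Lemma 3.17 (p0017 L136–L149)] -/
theorem thetaSpec_of_thetaSpecCFT {p q : ℕ} (hp : p.Prime) (hq : q.Prime) (D : GenusPointData (2 * (p * q)))
    (θ : D.H ≃ₐ[ℚ] D.H) (h : thetaSpecCFT D θ) : thetaSpec D θ := by
  obtain ⟨h0, hi, h2, hrest⟩ := h
  refine ⟨h0, hi, ?_, hrest⟩
  have hN0 : 2 * (p * q) ≠ 0 := Nat.mul_ne_zero two_ne_zero (Nat.mul_ne_zero hp.ne_zero hq.ne_zero)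
  have h2N : 2 ∈ (2 * (p * q)).divisors := Nat.mem_divisors.mpr ⟨Dvd.intro _ rfl, hN0⟩
  have hsq2 : D.sqrtNeg 2 ^ 2 = -((2 : ℕ) : D.H) := D.sqrtNeg_sq 2 h2N
  have hs : (D.im * D.sqrtNeg 2) ^ 2 = 2 := by
    rw [mul_pow, D.im_sq, hsq2]; push_cast; ring
  have hθi : θ.toAlgHom D.im = -D.im := hi
  have hθs : θ.toAlgHom (D.im * D.sqrtNeg 2) = D.im * D.sqrtNeg 2 := by
    show θ (D.im * D.sqrtNeg 2) = D.im * D.sqrtNeg 2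
    rw [map_mul, hi, h2]; ring
  intro t ht
  exact exists_map_sub_eq_zsmul_of_four_nsmul_eq_zero θ.toAlgHom D.im (D.im * D.sqrtNeg 2) D.im_sq hs hθi hθs t ht

/-- **THEOREM B from the REDUCED package**: `D.Printed`, `thetaSpecCFT D θ`, GZK, `g(2pq)` odd ⟹ `𝓛(2pq)` (the
data's sign choice) is odd. [cite: TianYuanZhang2017, Thm. 3.5 (p0011 L94–L112), Lemma 3.18 (p0017 L152–L153)] -/
theorem ThetaDescent.odd_scriptL_of_thetaSpecCFT {p q : ℕ} (hp : p.Prime) (hq : q.Prime) (hp5 : p % 8 = 5)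
    (hq4 : q % 4 = 3) (hGZK : rank_eq_analyticRank_of_analyticRank_le_one) (D : GenusPointData (2 * (p * q)))
    (hD : D.Printed) (θ : D.H ≃ₐ[ℚ] D.H) (hθ : thetaSpecCFT D θ) (hg : Odd (gK (2 * (p * q)))) :
    Odd (D.scriptL (2 * (p * q))) :=
  odd_scriptL_of_thetaSpec hp hq hp5 hq4 hGZK D hD θ (thetaSpec_of_thetaSpecCFT hp hq D θ hθ) hg

/-! ## §6 THEOREM B in tree currency from the hypothesis package (the shape the landed hook consumes) -/

/-- **Route B, display form ⟹ THEOREM B in tree currency**: from `thetaGenusPointDatum` (TYZ data + PROOF-B's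
`θ`-package), GZK, and `g(2pq)` odd: `∃ L` odd with `IsScriptL (2pq) L`, for all primes `p ≡ 5 (mod 8)`,
`q ≡ 3 (mod 4)` — exactly the hypothesis `hThmB` of the landed hook `P2/CongruentNumberSilentEvenFiveProofBHook.lean`.
CONDITIONAL on the display; nothing asserted. [cite: TianYuanZhang2017, Thm. 3.5 and §3] -/
theorem theoremB_of_thetaGenusPointDatum
    (hΘ : ∀ p q : ℕ, p.Prime → q.Prime → p % 8 = 5 → q % 4 = 3 → thetaGenusPointDatum p q)
    (hGZK : rank_eq_analyticRank_of_analyticRank_le_one) :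
    ∀ p q : ℕ, p.Prime → q.Prime → p % 8 = 5 → q % 4 = 3 →
      Odd (genusClassNumber (GenusField (2 * (p * q)))) → ∃ L : ℤ, Odd L ∧ IsScriptL (2 * (p * q)) L := by
  intro p q hp hq hp5 hq4 hg
  obtain ⟨D, hD, θ, hθ⟩ := hΘ p q hp hq hp5 hq4
  have hN0 : 2 * (p * q) ≠ 0 := Nat.mul_ne_zero two_ne_zero (Nat.mul_ne_zero hp.ne_zero hq.ne_zero)
  have hn1 : 1 < 2 * (p * q) := by
    have := Nat.mul_pos hp.pos hq.pos; omega
  refine ⟨D.scriptL (2 * (p * q)), odd_scriptL_of_thetaSpec hp hq hp5 hq4 hGZK D hD θ hθ hg, ?_⟩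
  exact hD.1 _ (Nat.mem_divisors_self _ hN0) hn1


/-- **THEOREM B in tree currency WITHOUT GZK**: from the display and Monsky 1990 Cor 5.15 (rank one on the family) —
`g(2pq)` odd ⟹ `∃ L` odd, `IsScriptL (2pq) L`. [cite: Monsky1990MockHeegner, Cor. 5.15 (2′) (p. 66)] [cite: TianYuanZhang2017, Thm. 3.5] -/
theorem theoremB_of_thetaGenusPointDatum_of_cor515
    (hΘ : ∀ p q : ℕ, p.Prime → q.Prime → p % 8 = 5 → q % 4 = 3 → thetaGenusPointDatum p q)
    (h515 : cor515_rank_eq_one_and_card_selmerGroup_two) :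
    ∀ p q : ℕ, p.Prime → q.Prime → p % 8 = 5 → q % 4 = 3 →
      Odd (genusClassNumber (GenusField (2 * (p * q)))) → ∃ L : ℤ, Odd L ∧ IsScriptL (2 * (p * q)) L := by
  intro p q hp hq hp5 hq4 hg
  obtain ⟨D, hD, θ, hθ⟩ := hΘ p q hp hq hp5 hq4
  have hN0 : 2 * (p * q) ≠ 0 := Nat.mul_ne_zero two_ne_zero (Nat.mul_ne_zero hp.ne_zero hq.ne_zero)
  have hn1 : 1 < 2 * (p * q) := by
    have := Nat.mul_pos hp.pos hq.pos; omega
  refine ⟨D.scriptL (2 * (p * q)), odd_scriptL_of_thetaSpec_of_cor515 hp hq hp5 hq4 h515 D hD θ hθ hg, ?_⟩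
  exact hD.1 _ (Nat.mem_divisors_self _ hN0) hn1


end Summit.BirchSwinnertonDyer.Rank1Residual.P2

end
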